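import Literature.NumberTheory.LFunctions.SelbergApproxFormulaMeanSquare
import Literature.NumberTheory.LFunctions.SelbergZeroDensityNearHalf
import HarnessLib

/-!
# Discharge of the Selberg–Fujii large-gap fact (Titchmarsh (9.25.5))

Topic `Literature/NumberTheory/LFunctions`. Proofs only (no definitions, no named facts).

* `Literature.NumberTheory.LFunctions.selberg_fujii_large_gaps_holds : selberg_fujii_large_gaps`
  (the small-gap twin `selberg_fujii_small_gaps_holds` is discharged independently in
  `SelbergFujiiSmallGapsProofs.lean`, through the `L¹` theory of `S(t+h) − S(t)`; it also follows from
  `SelbergMeanSquare.selberg_fujii_small_gaps_of_zeroDensity` exactly as below).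

The named facts of `ZeroGaps.lean` — Titchmarsh, *The Theory of the Riemann Zeta-Function*, §9.25
(9.25.5): "there is `λ > 1` such that `(γ_{n+1} − γ_n)/(2π/log γ_n) ≥ λ` for a positive proportion of
`n`", and (9.25.6): the same with `≤ λ < 1` (A. Fujii, Proc. Japan Acad. 51 (1975) 741–743, on the
basis of Selberg's *Contributions* (1946)) — follow by
`Literature.NumberTheory.LFunctions.SelbergMeanSquare.selberg_fujii_large_gaps_of_zeroDensity` /
`…small_gaps_of_zeroDensity` (`SelbergApproxFormulaMeanSquare.lean`: Selberg's mean-value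
approximate formula for `S(t)` from a zero-density hypothesis near the critical line, and the whole
§9.26 argument behind it, `SelbergFujii*.lean`) from Selberg's zero-density theorem near the
critical line `Literature.NumberTheory.LFunctions.SelbergDensity.selberg_zeroDensity_near_half`
(`SelbergZeroDensityNearHalf.lean`, Titchmarsh Thm. 9.19 (C) with an unspecified exponent).

## References

* E. C. Titchmarsh, *The Theory of the Riemann Zeta-Function*, 2nd ed. rev. D. R. Heath-Brown (1986),
  §9.25 (9.25.5)–(9.25.6), §9.26, Thm. 9.19 (C). [cite: Titchmarsh1986, §9.25 (9.25.5)]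
* A. Fujii, *On the difference between r consecutive ordinates of the zeros of the Riemann zeta
  function*, Proc. Japan Acad. 51 (1975), 741–743.
* A. Selberg, *Contributions to the theory of the Riemann zeta-function*, Arch. Math. Naturvid. 48
  (1946), no. 5, 89–155.
-/

namespace Literature.NumberTheory.LFunctions

/-- **Selberg–Fujii large gaps (Titchmarsh (9.25.5)), discharged**: there is `λ > 1` such that
`(γ_{n+1} − γ_n)/(2π/log γ_n) ≥ λ` for a positive proportion of `n`.
[cite: Titchmarsh1986, §9.25 (9.25.5)] -/
theorem selberg_fujii_large_gaps_holds : selberg_fujii_large_gaps :=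
  SelbergMeanSquare.selberg_fujii_large_gaps_of_zeroDensity SelbergDensity.selberg_zeroDensity_near_half

end Literature.NumberTheory.LFunctions
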